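import Summits.CriticalPhenomena.SAWScalingLimit.Theorems.SAWDefectDecoherenceBoundaryClosureRSidePhase
import Summits.CriticalPhenomena.SAWScalingLimit.Theorems.SAWDefectDecoherenceBoundaryClosureRZigzagHalfLattice
import HarnessLib

/-!
# Crux `BoundaryClosureR` (stmt-CriticalPhenomena-14004), line `polygon-parity-squeeze`:
# winding transfer along flat zigzag sides of forms `0`, `3`, `2` (support for the corner phase
# relation `sidePhase_corner`, sub-goal (A1b') of `stub_polygonIdentification`)

Winding-level ("existence") form of the straight gate `BoundaryExactness.straightGate`, and its
transport to the two slanted lattice directions that meet a horizontal floor at a lattice corner: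

* `floor_transfer` (form `0`): on a flat floor segment `k₁ ≤ k ≤ k₂` of row `m` (up faces
  `(k,m,0) ∈ Λ`, faces `(k,m-1,1)` below them off `Λ`, connecting down faces `(k,m,1) ∈ Λ`) none of
  whose darts is the root, every walk from the root to one floor dart is matched by a walk to any
  other floor dart WITH THE SAME WINDING (`exists_step_east/west` iterated);
* `side3_transfer` (form `3`, darts `{(c+1,y,0) ∉ Λ, (c,y,1) ∈ Λ}` of a column `x₀ = c`, heading
  `-30°`, connected through `(c,y+1,0) ∈ Λ`): the same, by transporting along `σ⁻¹`
  (`σ = hexRot60`, centres multiplied by `conj ζ`), which straightens the column into a floor of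
  row `-c-1`;
* `side2_transfer` (form `2`, darts `{(c-1,y,1) ∉ Λ, (c,y,0) ∈ Λ}`, heading `150°`, connected
  through `(c,y,1) ∈ Λ`): the same along `σ²`, which turns the column into a floor of row `c`
  traversed westwards.

Walks and windings are transported by `InteriorFlattening.Liouville.Transport.exists_walk_map` /
`winding_eq_of_verts_eq` (graph automorphisms acting by complex-affine maps preserve windings).
Sources: H. Duminil-Copin, S. Smirnov, Ann. of Math. 175 (2012), §3 (the winding of walks to the
boundary is rigid).  No definition is introduced.
-/

noncomputable section

open Literature.Probability.LatticeModels Literature.Probability.RandomPlanarGeometry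
open Literature.Probability.RandomPlanarGeometry.SAW
open Summit.CriticalPhenomena.SAWScalingLimit.Theorems.PickHalfPlane
open Summit.CriticalPhenomena.SAWScalingLimit.Theorems.ObservableToSLER.BridgeGate (hexRot60 hexRotNeg60
  hexRotIso hexRotIso_succ_apply hexRotIso_zero_apply hexCenter_hexRotIso triZeta_pow_ne_zero
  hexCenter_hexRotIso_symm_affine mem_image_hexRotIso_symm_iff conj_triZeta_pow_mul_self)
open Summit.CriticalPhenomena.SAWScalingLimit.Theorems.InteriorFlattening.Liouville.Transport

namespace Summit.CriticalPhenomena.SAWScalingLimit.Theorems.PolygonParitySqueeze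

namespace SidePhaseCorner

variable {Λ : Finset HexVertex}

/-! ### 1. Transport of walks and windings -/

/-- Rewriting the domain and the two end mid-edges of a walk along equalities keeps a walk with
the same winding. [folklore] -/
theorem exists_walk_of_eq {Λ Λ' : Finset HexVertex} {a a' z z' : Sym2 HexVertex} (hΛ : Λ = Λ')
    (ha : a = a') (hz : z = z') (γ : HexMidEdgeSAW Λ a z) :
    ∃ γ' : HexMidEdgeSAW Λ' a' z', γ'.winding = γ.winding := by
  subst hΛ ha hz
  exact ⟨γ, rfl⟩

/-- **Transport of a walk with its winding** along a graph automorphism of `ℍ` acting on the face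
centres by a complex-affine map `z ↦ α z + β`, `α ≠ 0`. [folklore] -/
theorem walk_transfer (S : hexGraph ≃g hexGraph) {α β : ℂ} (hα : α ≠ 0)
    (hS : ∀ f, hexCenter (S f) = α * hexCenter f + β) {a z : Sym2 HexVertex}
    (γ : HexMidEdgeSAW Λ a z) :
    ∃ γ' : HexMidEdgeSAW (Λ.image S) (a.map S) (z.map S), γ'.winding = γ.winding := by
  obtain ⟨γ', h⟩ := exists_walk_map S (Λ₂ := Λ.image S)
    (fun v hv => Finset.mem_image_of_mem _ hv) rfl rfl γ
  exact ⟨γ', winding_eq_of_verts_eq S hα hS γ γ' h⟩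

/-! ### 2. Form `0`: winding transfer along a flat floor -/

/-- **Winding transfer along a flat floor** (existence form of the straight gate). On a flat floor
`k₁ ≤ k ≤ k₂` of row `m` of a simply connected `Λ` (up faces `(k,m,0) ∈ Λ`, the faces `(k,m-1,1)`
below them off `Λ`, the down faces `(k,m,1)`, `k < k₂`, in `Λ`) none of whose floor darts is the
boundary root `{u, w}`, every walk from the root to the floor dart of column `kb` is matched by a
walk to the floor dart of any column `ke` with the same winding (step one column at a time,
`BoundaryExactness.exists_step_east` / `exists_step_west`).
[cite: DuminilCopinSmirnov2012, §3 (winding of walks to the boundary)] -/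
theorem floor_transfer (hΛ : hexDomainSimplyConnected Λ) {u w : HexVertex}
    (huw : hexGraph.Adj u w) (hu : u ∉ Λ) (hw : w ∈ Λ) {m k₁ k₂ : ℤ}
    (hF : ∀ k : ℤ, k₁ ≤ k → k ≤ k₂ → ((![k, m], 0) : HexVertex) ∈ Λ ∧
      ((![k, m - 1], 1) : HexVertex) ∉ Λ ∧ (k < k₂ → ((![k, m], 1) : HexVertex) ∈ Λ))
    (hroot : ∀ k : ℤ, k₁ ≤ k → k ≤ k₂ →
      s(((![k, m - 1], 1) : HexVertex), ((![k, m], 0) : HexVertex)) ≠ s(u, w))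
    {kb ke : ℤ} (hkb₁ : k₁ ≤ kb) (hkb₂ : kb ≤ k₂) (hke₁ : k₁ ≤ ke) (hke₂ : ke ≤ k₂)
    (γb : HexMidEdgeSAW Λ s(u, w) s(((![kb, m - 1], 1) : HexVertex), ((![kb, m], 0) : HexVertex))) :
    ∃ γe : HexMidEdgeSAW Λ s(u, w) s(((![ke, m - 1], 1) : HexVertex), ((![ke, m], 0) : HexVertex)),
      γe.winding = γb.winding := by
  rcases le_or_gt kb ke with hle | hlt
  · have key : ∀ k, kb ≤ k → k ≤ ke → ∃ δ : HexMidEdgeSAW Λ s(u, w)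
        s(((![k, m - 1], 1) : HexVertex), ((![k, m], 0) : HexVertex)), δ.winding = γb.winding := by
      intro k hk
      induction k, hk using Int.leInduction with
      | base => exact fun _ => ⟨γb, rfl⟩
      | succ k hk ih =>
        intro hk1
        obtain ⟨δ, hδ⟩ := ih (by omega)
        have h0 := hF k (by omega) (by omega)
        have h1 := hF (k + 1) (by omega) (by omega)
        obtain ⟨δ₁, hδ₁⟩ := BoundaryExactness.exists_step_east hΛ huw hu hw rfl h0.1
          (h0.2.2 (by omega)) h1.1 h0.2.1 h1.2.1 (hroot k (by omega) (by omega)).symm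
          (hroot (k + 1) (by omega) (by omega)).symm δ
        exact ⟨δ₁, hδ₁.trans hδ⟩
    exact key ke hle le_rfl
  · have key : ∀ k, k ≤ kb → ke ≤ k → ∃ δ : HexMidEdgeSAW Λ s(u, w)
        s(((![k, m - 1], 1) : HexVertex), ((![k, m], 0) : HexVertex)), δ.winding = γb.winding := by
      intro k hk
      induction k, hk using Int.leInductionDown with
      | base => exact fun _ => ⟨γb, rfl⟩
      | pred k hk ih =>
        intro hk1
        obtain ⟨δ, hδ⟩ := ih (by omega)
        have h0 := hF (k - 1) (by omega) (by omega)
        have h1 := hF k (by omega) (by omega)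
        obtain ⟨δ₀, hδ₀⟩ := BoundaryExactness.exists_step_west hΛ huw hu hw (k := k - 1) (k' := k)
          (by ring) h0.1 (h0.2.2 (by omega)) h1.1 h0.2.1 h1.2.1
          (hroot (k - 1) (by omega) (by omega)).symm (hroot k (by omega) (by omega)).symm δ
        exact ⟨δ₀, hδ₀.trans hδ⟩
    exact key ke hlt.le le_rfl

/-! ### 3. Form `3`: the column `x₀ = c` with darts heading `-30°` -/

/-- `σ` on the three face families of the straightened floor of row `-c-1`: up faces go to the
dart faces `(c,y,1)`, the faces below to the far ends `(c+1,y,0)`, down faces to the connectors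
`(c,y+1,0)` (`y = k-c-1`). [folklore] -/
theorem hexRot60_floor_three (c k : ℤ) :
    hexRot60 ((![k, -c - 1], 0) : HexVertex) = (![c, k - c - 1], 1) ∧
    hexRot60 ((![k, -c - 1 - 1], 1) : HexVertex) = (![c + 1, k - c - 1], 0) ∧
    hexRot60 ((![k, -c - 1], 1) : HexVertex) = (![c, k - c - 1 + 1], 0) := by
  refine ⟨?_, ?_, ?_⟩ <;> simp only [hexRot60] <;> rw [BoundaryExactness.mk_eq_mk_iff] <;>
    simp <;> omega

/-- `σ⁻¹` on a form-`3` dart: `(c+1,y,0) ↦ (y+c+1, -c-2, 1)`, `(c,y,1) ↦ (y+c+1, -c-1, 0)` — the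
floor dart of column `y+c+1`, row `-c-1`. [folklore] -/
theorem hexRotNeg60_dart_three (c y : ℤ) :
    hexRotNeg60 ((![c + 1, y], 0) : HexVertex) = (![y + c + 1, -c - 1 - 1], 1) ∧
    hexRotNeg60 ((![c, y], 1) : HexVertex) = (![y + c + 1, -c - 1], 0) := by
  refine ⟨?_, ?_⟩ <;> simp only [hexRotNeg60] <;> rw [BoundaryExactness.mk_eq_mk_iff] <;>
    simp <;> omega

/-- **Winding transfer along a flat side of form `3`.** On a column `x₀ = c`, heights
`y₁ ≤ y ≤ y₂`, with dart faces `(c,y,1) ∈ Λ`, far ends `(c+1,y,0) ∉ Λ` and connectors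
`(c,y+1,0) ∈ Λ` (`y < y₂`), none of whose darts `{(c+1,y,0), (c,y,1)}` is the boundary root
`{u, w}` of the simply connected `Λ`, every walk from the root to the dart at height `yb` is matched
by a walk to the dart at any height `ye` with the same winding: transport along `σ⁻¹` (centres
multiplied by `conj ζ`, windings preserved) to a flat floor of row `-c-1`, `floor_transfer`, and
transport back. [cite: DuminilCopinSmirnov2012, §3 (winding of walks to the boundary)] -/
theorem side3_transfer (hΛ : hexDomainSimplyConnected Λ) {u w : HexVertex}
    (huw : hexGraph.Adj u w) (hu : u ∉ Λ) (hw : w ∈ Λ) {c y₁ y₂ : ℤ}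
    (hF : ∀ y : ℤ, y₁ ≤ y → y ≤ y₂ → ((![c, y], 1) : HexVertex) ∈ Λ ∧
      ((![c + 1, y], 0) : HexVertex) ∉ Λ ∧ (y < y₂ → ((![c, y + 1], 0) : HexVertex) ∈ Λ))
    (hroot : ∀ y : ℤ, y₁ ≤ y → y ≤ y₂ →
      s(((![c + 1, y], 0) : HexVertex), ((![c, y], 1) : HexVertex)) ≠ s(u, w))
    {yb ye : ℤ} (hyb₁ : y₁ ≤ yb) (hyb₂ : yb ≤ y₂) (hye₁ : y₁ ≤ ye) (hye₂ : ye ≤ y₂)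
    (γb : HexMidEdgeSAW Λ s(u, w) s(((![c + 1, yb], 0) : HexVertex), ((![c, yb], 1) : HexVertex))) :
    ∃ γe : HexMidEdgeSAW Λ s(u, w) s(((![c + 1, ye], 0) : HexVertex), ((![c, ye], 1) : HexVertex)),
      γe.winding = γb.winding := by
  -- the transporting automorphism `T = σ⁻¹` and its inverse `S = σ`
  have hT : ∀ f : HexVertex, hexCenter ((hexRotIso 1).symm f) =
      (starRingEnd ℂ) (triZeta ^ 1) * hexCenter f + 0 := hexCenter_hexRotIso_symm_affine 1
  have hS : ∀ f : HexVertex, hexCenter (hexRotIso 1 f) = triZeta ^ 1 * hexCenter f + 0 := fun f => by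
    rw [hexCenter_hexRotIso, add_zero]
  have hαT : (starRingEnd ℂ) (triZeta ^ 1) ≠ 0 :=
    left_ne_zero_of_mul_eq_one (conj_triZeta_pow_mul_self 1)
  have hS1 : ∀ f : HexVertex, hexRotIso 1 f = hexRot60 f := fun f => rfl
  have hT1 : ∀ f : HexVertex, (hexRotIso 1).symm f = hexRotNeg60 f := fun f => rfl
  -- the image domain and its root
  have hΛ' : hexDomainSimplyConnected (Λ.image (hexRotIso 1).symm) :=
    (hexDomainSimplyConnected_image_iff _ Λ).2 hΛ
  have huw' : hexGraph.Adj ((hexRotIso 1).symm u) ((hexRotIso 1).symm w) :=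
    (RelIso.map_rel_iff _).2 huw
  have hu' : (hexRotIso 1).symm u ∉ Λ.image (hexRotIso 1).symm :=
    fun h => hu ((RelIso.injective _).mem_finset_image.1 h)
  have hw' : (hexRotIso 1).symm w ∈ Λ.image (hexRotIso 1).symm :=
    (RelIso.injective _).mem_finset_image.2 hw
  -- the flat floor of row `-c-1`, columns `y₁+c+1 … y₂+c+1`, in the image domain
  have hF' : ∀ k : ℤ, y₁ + c + 1 ≤ k → k ≤ y₂ + c + 1 →
      ((![k, -c - 1], 0) : HexVertex) ∈ Λ.image (hexRotIso 1).symm ∧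
      ((![k, -c - 1 - 1], 1) : HexVertex) ∉ Λ.image (hexRotIso 1).symm ∧
      (k < y₂ + c + 1 → ((![k, -c - 1], 1) : HexVertex) ∈ Λ.image (hexRotIso 1).symm) := by
    intro k hk₁ hk₂
    obtain ⟨h1, h2, h3⟩ := hF (k - c - 1) (by omega) (by omega)
    obtain ⟨e1, e2, e3⟩ := hexRot60_floor_three c k
    refine ⟨?_, ?_, fun hk => ?_⟩
    · rw [mem_image_hexRotIso_symm_iff, hS1, e1]; exact h1
    · rw [mem_image_hexRotIso_symm_iff, hS1, e2]; exact h2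
    · rw [mem_image_hexRotIso_symm_iff, hS1, e3]; exact h3 (by omega)
  have hroot' : ∀ k : ℤ, y₁ + c + 1 ≤ k → k ≤ y₂ + c + 1 →
      s(((![k, -c - 1 - 1], 1) : HexVertex), ((![k, -c - 1], 0) : HexVertex)) ≠
        s((hexRotIso 1).symm u, (hexRotIso 1).symm w) := by
    intro k hk₁ hk₂ h
    have h' := congrArg (Sym2.map (hexRotIso 1)) h
    rw [Sym2.map_mk, Sym2.map_mk, RelIso.apply_symm_apply, RelIso.apply_symm_apply, hS1,
      hS1, (hexRot60_floor_three c k).2.1, (hexRot60_floor_three c k).1] at h'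
    exact hroot (k - c - 1) (by omega) (by omega) h'
  -- transport the walk, transfer along the floor, transport back
  obtain ⟨γ₁, hγ₁⟩ := walk_transfer (hexRotIso 1).symm hαT hT γb
  obtain ⟨γ₂, hγ₂⟩ := exists_walk_of_eq rfl (Sym2.map_mk _ _ _)
    (show Sym2.map ((hexRotIso 1).symm) s(((![c + 1, yb], 0) : HexVertex), (![c, yb], 1)) =
        s(((![yb + c + 1, -c - 1 - 1], 1) : HexVertex), (![yb + c + 1, -c - 1], 0)) by
      rw [Sym2.map_mk, hT1, hT1, (hexRotNeg60_dart_three c yb).1,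
        (hexRotNeg60_dart_three c yb).2]) γ₁
  obtain ⟨γ₃, hγ₃⟩ := floor_transfer hΛ' huw' hu' hw' hF' hroot' (kb := yb + c + 1)
    (ke := ye + c + 1) (by omega) (by omega) (by omega) (by omega) γ₂
  obtain ⟨γ₄, hγ₄⟩ := walk_transfer (hexRotIso 1) (triZeta_pow_ne_zero 1) hS γ₃
  obtain ⟨γ₅, hγ₅⟩ := exists_walk_of_eq (image_image_symm (hexRotIso 1) Λ)
    (show Sym2.map (hexRotIso 1) s((hexRotIso 1).symm u, (hexRotIso 1).symm w) = s(u, w) by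
      rw [Sym2.map_mk, RelIso.apply_symm_apply, RelIso.apply_symm_apply])
    (show Sym2.map (hexRotIso 1) s(((![ye + c + 1, -c - 1 - 1], 1) : HexVertex),
        (![ye + c + 1, -c - 1], 0)) = s(((![c + 1, ye], 0) : HexVertex), (![c, ye], 1)) by
      rw [Sym2.map_mk, hS1, hS1, (hexRot60_floor_three c (ye + c + 1)).2.1,
        (hexRot60_floor_three c (ye + c + 1)).1]
      congr 3 <;> ring_nf) γ₄
  exact ⟨γ₅, by rw [hγ₅, hγ₄, hγ₃, hγ₂, hγ₁]⟩


/-! ### 4. Form `2`: the column `x₀ = c` with darts heading `150°` -/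

/-- `σ⁻²` on the three face families of the floor of row `c` obtained from the form-`2` column
`x₀ = c` (`y = -i-c-1`): up faces go to the dart faces `(c,y,0)`, the faces below to the far ends
`(c-1,y,1)`, down faces to the connectors `(c,y-1,1)`. [folklore] -/
theorem hexRotNeg60_sq_floor_two (c i : ℤ) :
    hexRotNeg60 (hexRotNeg60 ((![i, c], 0) : HexVertex)) = (![c, -i - c - 1], 0) ∧
    hexRotNeg60 (hexRotNeg60 ((![i, c - 1], 1) : HexVertex)) = (![c - 1, -i - c - 1], 1) ∧
    hexRotNeg60 (hexRotNeg60 ((![i, c], 1) : HexVertex)) = (![c, -i - c - 1 - 1], 1) := by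
  refine ⟨?_, ?_, ?_⟩ <;> simp only [hexRotNeg60] <;> rw [BoundaryExactness.mk_eq_mk_iff] <;>
    simp <;> omega

/-- `σ²` on a form-`2` dart: `(c-1,y,1) ↦ (-y-c-1, c-1, 1)`, `(c,y,0) ↦ (-y-c-1, c, 0)` — the floor
dart of column `-y-c-1`, row `c`. [folklore] -/
theorem hexRot60_sq_dart_two (c y : ℤ) :
    hexRot60 (hexRot60 ((![c - 1, y], 1) : HexVertex)) = (![-y - c - 1, c - 1], 1) ∧
    hexRot60 (hexRot60 ((![c, y], 0) : HexVertex)) = (![-y - c - 1, c], 0) := by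
  refine ⟨?_, ?_⟩ <;> simp only [hexRot60] <;> rw [BoundaryExactness.mk_eq_mk_iff] <;>
    simp <;> omega

/-- **Winding transfer along a flat side of form `2`.** On a column `x₀ = c`, heights
`y₁ ≤ y ≤ y₂`, with dart faces `(c,y,0) ∈ Λ`, far ends `(c-1,y,1) ∉ Λ` and connectors
`(c,y,1) ∈ Λ` (`y < y₂`), none of whose darts `{(c-1,y,1), (c,y,0)}` is the boundary root `{u, w}`
of the simply connected `Λ`, every walk from the root to the dart at height `yb` is matched by a
walk to the dart at any height `ye` with the same winding: transport along `σ²` (centres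
multiplied by `ζ²`) to a flat floor of row `c` (traversed westwards), `floor_transfer`, and back.
[cite: DuminilCopinSmirnov2012, §3 (winding of walks to the boundary)] -/
theorem side2_transfer (hΛ : hexDomainSimplyConnected Λ) {u w : HexVertex}
    (huw : hexGraph.Adj u w) (hu : u ∉ Λ) (hw : w ∈ Λ) {c y₁ y₂ : ℤ}
    (hF : ∀ y : ℤ, y₁ ≤ y → y ≤ y₂ → ((![c, y], 0) : HexVertex) ∈ Λ ∧
      ((![c - 1, y], 1) : HexVertex) ∉ Λ ∧ (y < y₂ → ((![c, y], 1) : HexVertex) ∈ Λ))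
    (hroot : ∀ y : ℤ, y₁ ≤ y → y ≤ y₂ →
      s(((![c - 1, y], 1) : HexVertex), ((![c, y], 0) : HexVertex)) ≠ s(u, w))
    {yb ye : ℤ} (hyb₁ : y₁ ≤ yb) (hyb₂ : yb ≤ y₂) (hye₁ : y₁ ≤ ye) (hye₂ : ye ≤ y₂)
    (γb : HexMidEdgeSAW Λ s(u, w) s(((![c - 1, yb], 1) : HexVertex), ((![c, yb], 0) : HexVertex))) :
    ∃ γe : HexMidEdgeSAW Λ s(u, w) s(((![c - 1, ye], 1) : HexVertex), ((![c, ye], 0) : HexVertex)),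
      γe.winding = γb.winding := by
  -- the transporting automorphism `S = σ²` and its inverse
  have hS : ∀ f : HexVertex, hexCenter (hexRotIso 2 f) = triZeta ^ 2 * hexCenter f + 0 := fun f => by
    rw [hexCenter_hexRotIso, add_zero]
  have hT : ∀ f : HexVertex, hexCenter ((hexRotIso 2).symm f) =
      (starRingEnd ℂ) (triZeta ^ 2) * hexCenter f + 0 := hexCenter_hexRotIso_symm_affine 2
  have hαT : (starRingEnd ℂ) (triZeta ^ 2) ≠ 0 :=
    left_ne_zero_of_mul_eq_one (conj_triZeta_pow_mul_self 2)
  have hS2 : ∀ f : HexVertex, hexRotIso 2 f = hexRot60 (hexRot60 f) := fun f => rfl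
  have hT2 : ∀ f : HexVertex, (hexRotIso 2).symm f = hexRotNeg60 (hexRotNeg60 f) := fun f => rfl
  -- the image domain and its root
  have hΛ' : hexDomainSimplyConnected (Λ.image (hexRotIso 2)) :=
    (hexDomainSimplyConnected_image_iff _ Λ).2 hΛ
  have huw' : hexGraph.Adj (hexRotIso 2 u) (hexRotIso 2 w) := (RelIso.map_rel_iff _).2 huw
  have hu' : hexRotIso 2 u ∉ Λ.image (hexRotIso 2) :=
    fun h => hu ((RelIso.injective _).mem_finset_image.1 h)
  have hw' : hexRotIso 2 w ∈ Λ.image (hexRotIso 2) := (RelIso.injective _).mem_finset_image.2 hw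
  -- the flat floor of row `c`, columns `-y₂-c-1 … -y₁-c-1`, in the image domain
  have hF' : ∀ i : ℤ, -y₂ - c - 1 ≤ i → i ≤ -y₁ - c - 1 →
      ((![i, c], 0) : HexVertex) ∈ Λ.image (hexRotIso 2) ∧
      ((![i, c - 1], 1) : HexVertex) ∉ Λ.image (hexRotIso 2) ∧
      (i < -y₁ - c - 1 → ((![i, c], 1) : HexVertex) ∈ Λ.image (hexRotIso 2)) := by
    intro i hi₁ hi₂
    obtain ⟨h1, h2, -⟩ := hF (-i - c - 1) (by omega) (by omega)
    obtain ⟨e1, e2, e3⟩ := hexRotNeg60_sq_floor_two c i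
    refine ⟨?_, ?_, fun hi => ?_⟩
    · rw [mem_image_iff, hT2, e1]; exact h1
    · rw [mem_image_iff, hT2, e2]; exact h2
    · rw [mem_image_iff, hT2, e3]
      exact (hF (-i - c - 1 - 1) (by omega) (by omega)).2.2 (by omega)
  have hroot' : ∀ i : ℤ, -y₂ - c - 1 ≤ i → i ≤ -y₁ - c - 1 →
      s(((![i, c - 1], 1) : HexVertex), ((![i, c], 0) : HexVertex)) ≠
        s(hexRotIso 2 u, hexRotIso 2 w) := by
    intro i hi₁ hi₂ h
    have h' := congrArg (Sym2.map (hexRotIso 2).symm) h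
    rw [Sym2.map_mk, Sym2.map_mk, RelIso.symm_apply_apply, RelIso.symm_apply_apply, hT2,
      hT2, (hexRotNeg60_sq_floor_two c i).2.1, (hexRotNeg60_sq_floor_two c i).1] at h'
    exact hroot (-i - c - 1) (by omega) (by omega) h'
  -- transport the walk, transfer along the floor, transport back
  obtain ⟨γ₁, hγ₁⟩ := walk_transfer (hexRotIso 2) (triZeta_pow_ne_zero 2) hS γb
  obtain ⟨γ₂, hγ₂⟩ := exists_walk_of_eq rfl (Sym2.map_mk _ _ _)
    (show Sym2.map (hexRotIso 2) s(((![c - 1, yb], 1) : HexVertex), (![c, yb], 0)) =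
        s(((![-yb - c - 1, c - 1], 1) : HexVertex), (![-yb - c - 1, c], 0)) by
      rw [Sym2.map_mk, hS2, hS2, (hexRot60_sq_dart_two c yb).1, (hexRot60_sq_dart_two c yb).2]) γ₁
  obtain ⟨γ₃, hγ₃⟩ := floor_transfer hΛ' huw' hu' hw' hF' hroot' (kb := -yb - c - 1)
    (ke := -ye - c - 1) (by omega) (by omega) (by omega) (by omega) γ₂
  obtain ⟨γ₄, hγ₄⟩ := walk_transfer (hexRotIso 2).symm hαT hT γ₃
  obtain ⟨γ₅, hγ₅⟩ := exists_walk_of_eq (image_symm_image (hexRotIso 2) Λ)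
    (show Sym2.map (hexRotIso 2).symm s(hexRotIso 2 u, hexRotIso 2 w) = s(u, w) by
      rw [Sym2.map_mk, RelIso.symm_apply_apply, RelIso.symm_apply_apply])
    (show Sym2.map (hexRotIso 2).symm s(((![-ye - c - 1, c - 1], 1) : HexVertex),
        (![-ye - c - 1, c], 0)) = s(((![c - 1, ye], 1) : HexVertex), (![c, ye], 0)) by
      rw [Sym2.map_mk, hT2, hT2, (hexRotNeg60_sq_floor_two c (-ye - c - 1)).2.1,
        (hexRotNeg60_sq_floor_two c (-ye - c - 1)).1]
      congr 3 <;> ring_nf) γ₄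
  exact ⟨γ₅, by rw [hγ₅, hγ₄, hγ₃, hγ₂, hγ₁]⟩

end SidePhaseCorner

/-! ### 5. Registered form -/

/-- **Registered helper `sidePhaseCorner_side3_transfer`** (support for `sidePhase_corner`, line
`polygon-parity-squeeze`, crux stmt-CriticalPhenomena-14004): winding transfer along a flat side of
form `3` (binder-free form of `SidePhaseCorner.side3_transfer`; the forms `0` and `2` are
`SidePhaseCorner.floor_transfer`, `SidePhaseCorner.side2_transfer`).
[cite: DuminilCopinSmirnov2012, §3 (winding of walks to the boundary)] -/
theorem sidePhaseCorner_side3_transfer : ∀ (Λ : Finset HexVertex), hexDomainSimplyConnected Λ → ∀ (u w : HexVertex), hexGraph.Adj u w → u ∉ Λ → w ∈ Λ → ∀ (c y₁ y₂ : ℤ), (∀ y : ℤ, y₁ ≤ y → y ≤ y₂ → ((![c, y], 1) : HexVertex) ∈ Λ ∧ ((![c + 1, y], 0) : HexVertex) ∉ Λ ∧ (y < y₂ → ((![c, y + 1], 0) : HexVertex) ∈ Λ)) → (∀ y : ℤ, y₁ ≤ y → y ≤ y₂ → s(((![c + 1, y], 0) : HexVertex), ((![c, y], 1) : HexVertex))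 ≠ s(u, w)) → ∀ (yb ye : ℤ), y₁ ≤ yb → yb ≤ y₂ → y₁ ≤ ye → ye ≤ y₂ → ∀ γb : HexMidEdgeSAW Λ s(u, w) s(((![c + 1, yb], 0) : HexVertex), ((![c, yb], 1) : HexVertex)), ∃ γe : HexMidEdgeSAW Λ s(u, w) s(((![c + 1, ye], 0) : HexVertex), ((![c, ye], 1) : HexVertex)), γe.winding = γb.winding :=
  fun _ hΛ _ _ huw hu hw _ _ _ hF hroot _ _ h1 h2 h3 h4 γb =>
    SidePhaseCorner.side3_transfer hΛ huw hu hw hF hroot h1 h2 h3 h4 γb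

end Summit.CriticalPhenomena.SAWScalingLimit.Theorems.PolygonParitySqueeze

end
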